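import Summits.AtomisticToContinuum.Crystallization.Theses.DisclinationRation
import Summits.AtomisticToContinuum.Crystallization.Theorems.DisclinationRationAlphabetGoodHullElementStubHullZeroMeanStressBoundary
import Summits.AtomisticToContinuum.Crystallization.Theorems.HullExactificationCascadeHullBulkOptimal
import Literature.MathematicalPhysics.StatisticalMechanics.LennardJonesThermodynamicLimitProofs
import HarnessLib

/-!
# Stub `stub_hullZeroMeanStress` of line `census-liouville`, crux `AlphabetGoodHullElement`
# (route `DisclinationRation`, item stmt-AtomisticToContinuum-15798) — III: the stub

HULL ELEMENTS OF LENNARD-JONES GROUND STATES HAVE ZERO MEAN STRESS.  For Lennard-Jones ground states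
`x^N` in `ℝ³`, a `δ`-separated `S` two-way matched on every ball by translates `x^(φ j) + τ_j`
(the line's `HL x S`), every continuous linear `A` and every `θ > 0` there is `L₀` with
`|Σ_{y ∈ S ∩ B̄_L(c)} Σ'_{z ∈ S, z ≠ y} V′(|y − z|)/|y − z| · ⟨y − z, A(y − z)⟩| ≤ θ L³` for all
`L ≥ L₀` and all centres `c` (`stub_hullZeroMeanStress`, the registered signature verbatim).

PROOF: Fermat for the affine family `y ↦ y + tAy` against bulk optimality.  With
`Y = S ∩ B̄_L(c)`, `n = #Y ≤ K₀ L³`, `G(t) = Σ_{y ≠ z ∈ Y} V(‖(y − z) + tA(y − z)‖)`, `D = G′(0)`: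
`G(±s) ≥ 2E(n)` (part II, `hzms_competitor`); `G(0) ≤ 2E(n) + εL³ + C₁L²/6` by the landed bulk
bound `HullBulkOptimal.sum_site_le_of_matched` (`≤ 2e_∞ n + εL³`), `e_∞ n ≤ E(n)`
(`BlancLewin2015_8_holds`) and the surface bound on the dropped cross terms (part II,
`hzms_cross_tsum_le`, `V ≥ −r⁻⁶/6`); `|G(±s) − G(0) ∓ sD| ≤ K n s²` (part II, `hzms_taylor_sum`);
so `s|D| ≤ εL³ + C₁L²/6 + KL³s²`, and the stub's double sum is `D` plus cross terms
`≤ (δ⁻⁶ + 1)‖A‖C₁L²`; `s = min(t₀, θ/(4(K+1)))`, `ε = θs/4`, `L₀` large (`hzms_endgame`).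
All `[folklore]` (Blanc–Lewin 2015 §1.2–§1.3, §2.2 for context; the virial / first-variation
identity of a bulk-optimal configuration).
-/

noncomputable section

namespace Summit.AtomisticToContinuum.Crystallization.Theorems.AlphabetGoodHullElementCensusLiouville

open scoped BigOperators RealInnerProductSpace Topology
open Filter Set Metric
open Literature.MathematicalPhysics.StatisticalMechanics
open Summit.AtomisticToContinuum.Crystallization.Theorems.HullBulkOptimal
  (ncard_ball_le tsum_finite_eq_sum abs_lennardJones_le)

open Summit.AtomisticToContinuum.Crystallization.Theorems.CoarseGrains.Negative.PredicateAPI (E3)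

/-! ## The real-arithmetic endgame -/

/-- **Fermat endgame (real arithmetic).** With `ε = θ s/4`, `K s ≤ θ/4`, `L ≥ 2C₁/(3sθ)`,
`L ≥ 4aC₁/θ`, `L ≥ 1`: the bulk bound `G0 + X ≤ 2E + εL³`, the boundary bound `X ≥ −C₁L²/6`,
the competitor bounds `2E ≤ G(±s)`, the Taylor bounds `|G(±s) − G0 ∓ sD| ≤ R± ≤ KL³s²` and the
cross-term bound `|X′| ≤ aC₁L²` give `|D + X′| ≤ θL³`. [folklore] -/
theorem hzms_endgame {θ s L K C₁ a ε En G0 Gp Gm D X X' Rp Rm : ℝ}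
    (hθ : 0 < θ) (hs : 0 < s) (hL : 1 ≤ L)
    (hε : ε = θ * s / 4) (hsK : K * s ≤ θ / 4)
    (hL1 : 2 * C₁ / (3 * s * θ) ≤ L) (hL2 : 4 * a * C₁ / θ ≤ L)
    (hU : G0 + X ≤ 2 * En + ε * L ^ 3) (hX : -(1 / 6 * (C₁ * L ^ 2)) ≤ X)
    (hGp : 2 * En ≤ Gp) (hGm : 2 * En ≤ Gm)
    (hTp : |Gp - G0 - s * D| ≤ Rp) (hTm : |Gm - G0 - -s * D| ≤ Rm)
    (hRp : Rp ≤ K * L ^ 3 * s ^ 2) (hRm : Rm ≤ K * L ^ 3 * s ^ 2)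
    (hX' : |X'| ≤ a * (C₁ * L ^ 2)) :
    |D + X'| ≤ θ * L ^ 3 := by
  have hL0 : 0 < L := by linarith
  -- `|s D| ≤ η`
  have h1 : s * D ≤ ε * L ^ 3 + 1 / 6 * (C₁ * L ^ 2) + K * L ^ 3 * s ^ 2 := by
    have h := (abs_le.1 hTm).2
    nlinarith [h]
  have h2 : -(s * D) ≤ ε * L ^ 3 + 1 / 6 * (C₁ * L ^ 2) + K * L ^ 3 * s ^ 2 := by
    have h := (abs_le.1 hTp).2
    nlinarith [h]
  have h3 : |s * D| ≤ ε * L ^ 3 + 1 / 6 * (C₁ * L ^ 2) + K * L ^ 3 * s ^ 2 :=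
    abs_le.2 ⟨by linarith, h1⟩
  -- the four budget items, each `≤ s θ L³ / 4`
  have hb1 : ε * L ^ 3 = s * θ * L ^ 3 / 4 := by rw [hε]; ring
  have hb2 : 1 / 6 * (C₁ * L ^ 2) ≤ s * θ * L ^ 3 / 4 := by
    have h := hL1
    rw [div_le_iff₀ (by positivity)] at h
    have h' : 2 * C₁ * L ^ 2 ≤ L * (3 * s * θ) * L ^ 2 := mul_le_mul_of_nonneg_right h (sq_nonneg L)
    nlinarith [h']
  have hb3 : K * L ^ 3 * s ^ 2 ≤ s * θ * L ^ 3 / 4 := by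
    have e1 : K * L ^ 3 * s ^ 2 = (K * s) * (s * L ^ 3) := by ring
    have e2 : s * θ * L ^ 3 / 4 = (θ / 4) * (s * L ^ 3) := by ring
    rw [e1, e2]
    exact mul_le_mul_of_nonneg_right hsK (by positivity)
  have hb4 : s * (a * (C₁ * L ^ 2)) ≤ s * θ * L ^ 3 / 4 := by
    have h := hL2
    rw [div_le_iff₀ hθ] at h
    have h' : 4 * a * C₁ * (s * L ^ 2) ≤ L * θ * (s * L ^ 2) :=
      mul_le_mul_of_nonneg_right h (by positivity)
    nlinarith [h']
  -- combine
  have h5 : s * |D + X'| ≤ |s * D| + s * |X'| := by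
    calc s * |D + X'| ≤ s * (|D| + |X'|) := mul_le_mul_of_nonneg_left (abs_add_le _ _) hs.le
      _ = |s * D| + s * |X'| := by rw [mul_add, abs_mul, abs_of_pos hs]
  have h6 : s * |X'| ≤ s * (a * (C₁ * L ^ 2)) := mul_le_mul_of_nonneg_left hX' hs.le
  have h7 : s * |D + X'| ≤ s * (θ * L ^ 3) := by
    have : s * (θ * L ^ 3) = 4 * (s * θ * L ^ 3 / 4) := by ring
    rw [this]
    linarith [h3, h5, h6, hb1, hb2, hb3, hb4]
  exact le_of_mul_le_mul_left h7 hs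

/-! ## The stub -/

/-- **STUB C of line `census-liouville` — hull elements of Lennard-Jones ground states have ZERO
MEAN STRESS.**  For a `δ`-separated hull element `S` (two-way matched on every ball by translated
ground states along a subsequence) and every continuous linear `A`, the first variation of the
ball site-sum under `y ↦ y + tAy`,
`Σ_{y ∈ S ∩ B̄_L(c)} Σ'_{z ∈ S, z ≠ y} V′(|y − z|)/|y − z| · ⟨y − z, A(y − z)⟩`, is `≤ θL³` in
absolute value for `L ≥ L₀(A, θ)`, uniformly in the centre `c`.

Proof: FERMAT FOR THE AFFINE FAMILY AGAINST BULK OPTIMALITY.  With `Y = S ∩ B̄_L(c)`,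
`n = #Y ≤ K₀L³`, `G(t) = Σ_{y ≠ z ∈ Y} V(‖(y − z) + tA(y − z)‖)`, `D = G′(0)`:
(i) `G(t) ≥ 2E(n)` for `|t|‖A‖ ≤ 1/2` (the deformed points are distinct: `hzms_competitor`);
(ii) `G(0) ≤ 2E(n) + εL³ + C₁L²/6` — the ball site-sum is `≤ 2e_∞ n + εL³`
(`HullBulkOptimal.sum_site_le_of_matched`), `e_∞ n ≤ E(n)` (`BlancLewin2015_8_holds`), and the
dropped cross terms over the sphere are `≥ −(1/6)Σ|y − z|⁻⁶ ≥ −C₁L²/6` (`hzms_cross_tsum_le`);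
(iii) `|G(±s) − G(0) ∓ sD| ≤ K n s²` (`hzms_taylor_sum`); hence `s|D| ≤ εL³ + C₁L²/6 + KL³s²`;
(iv) the stub's double sum differs from `D` by cross terms `≤ (δ⁻⁶ + 1)‖A‖ C₁L²`; choosing
`s = min(t₀, θ/(4(K + 1)))`, `ε = θs/4` and `L₀` large closes (`hzms_endgame`). [folklore] -/
theorem stub_hullZeroMeanStress : let HL : ((N : ℕ) → (Fin N → EuclideanSpace ℝ (Fin 3))) → Set (EuclideanSpace ℝ (Fin 3)) → Prop := fun x S => ∃ φ : ℕ → ℕ, StrictMono φ ∧ ∃ τ : ℕ → EuclideanSpace ℝ (Fin 3), ∀ R ε : ℝ, 0 < ε → ∀ᶠ j : ℕ in Filter.atTop, (∀ s ∈ S, ‖s‖ ≤ R → ∃ i : Fin (φ j), dist (x (φ j) i + τ j) s ≤ ε) ∧ (∀ i : Fin (φ j), ‖x (φ j) i + τ j‖ ≤ R → ∃ s ∈ S, dist (x (φ j) i + τ j) s ≤ ε); let ZMS : Set (EuclideanSpace ℝ (Fin 3)) → Prop := fun S => ∀ A : EuclideanSpace ℝ (Fin 3) →L[ℝ] EuclideanSpace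 ℝ (Fin 3), ∀ θ : ℝ, 0 < θ → ∃ L₀ : ℝ, ∀ L : ℝ, L₀ ≤ L → ∀ c : EuclideanSpace ℝ (Fin 3), |∑' y : ↥{y : EuclideanSpace ℝ (Fin 3) | y ∈ S ∧ dist y c ≤ L}, (∑' z : ↥{z : EuclideanSpace ℝ (Fin 3) | z ∈ S ∧ z ≠ (y : EuclideanSpace ℝ (Fin 3))}, deriv Literature.MathematicalPhysics.StatisticalMechanics.lennardJones (dist (y : EuclideanSpace ℝ (Fin 3)) (z : EuclideanSpace ℝ (Fin 3))) / dist (y : EuclideanSpace ℝ (Fin 3)) (z : EuclideanSpace ℝ (Fin 3)) * inner ℝ ((y : EuclideanSpace ℝ (Fin 3)) - (z : EuclideanSpace ℝ (Fin 3))) (A ((y : EuclideanSpace ℝ (Fin 3)) - (z : EuclideanSpace ℝ (Fin 3)))))| ≤ θ * L ^ 3; ∀ (x : (N : ℕ) → (Fin N → EuclideanSpace ℝ (Fin 3))), (∀ N, Literature.MathematicalPhysics.StatisticalMechanics.IsGroundState Literature.MathematicalPhysics.StatisticalMechanics.lennardJones (x N)) → ∀ (S : Set (EuclideanSpace ℝ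 (Fin 3))) (δ : ℝ), 0 < δ → (∀ y ∈ S, ∀ z ∈ S, y ≠ z → δ ≤ dist y z) → HL x S → ZMS S := by
  intro HL ZMS x hx S δ hδ hsep hHL
  obtain ⟨φ, -, τ, hlim⟩ := hHL
  intro A θ hθ
  classical
  /- (0) the constants -/
  obtain ⟨e, -, he_tend, he_le⟩ := BlancLewin2015_8_holds 3 (by norm_num) (by norm_num)
  obtain ⟨C₁, hC₁0, hcross⟩ := hzms_crossSum_finset hδ
  set K₀ : ℝ := (2 / δ + 1) ^ 3 with hK₀
  have hK₀pos : 0 < K₀ := by positivity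
  set K₄ : ℝ := 2 ^ 8 * (14 * (δ / 2)⁻¹ ^ 6 + 8) * ‖A‖ ^ 2 * (1024 / (δ ^ 3 * δ ^ 3)) with hK₄
  have hK₄0 : 0 ≤ K₄ := by positivity
  set K : ℝ := K₄ * K₀ with hK
  have hK0 : 0 ≤ K := by positivity
  set a : ℝ := (δ⁻¹ ^ 6 + 1) * ‖A‖ with ha
  have ha0 : 0 ≤ a := by positivity
  set t₀ : ℝ := 1 / (2 * (‖A‖ + 1)) with ht₀
  have ht₀pos : 0 < t₀ := by positivity
  have ht₀A : t₀ * ‖A‖ ≤ 1 / 2 := by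
    rw [ht₀, div_mul_eq_mul_div, one_mul, div_le_iff₀ (by positivity)]
    linarith [norm_nonneg A]
  set s : ℝ := min t₀ (θ / (4 * (K + 1))) with hs
  have hs0 : 0 < s := lt_min ht₀pos (by positivity)
  have hst₀ : s ≤ t₀ := min_le_left _ _
  have hsK : K * s ≤ θ / 4 := by
    have h1 : s ≤ θ / (4 * (K + 1)) := min_le_right _ _
    have h2 : K * s ≤ K * (θ / (4 * (K + 1))) := mul_le_mul_of_nonneg_left h1 hK0
    have h3 : K * (θ / (4 * (K + 1))) ≤ θ / 4 := by
      rw [mul_div_assoc', div_le_div_iff₀ (by positivity) (by positivity)]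
      nlinarith [mul_nonneg hK0 hθ.le]
    linarith
  have hsabs : |s| ≤ t₀ := by rw [abs_of_pos hs0]; exact hst₀
  have hsabs' : |(-s)| ≤ t₀ := by rw [abs_neg, abs_of_pos hs0]; exact hst₀
  have hsA : |s| * ‖A‖ ≤ 1 / 2 := (mul_le_mul_of_nonneg_right hsabs (norm_nonneg A)).trans ht₀A
  have hsA' : |(-s)| * ‖A‖ ≤ 1 / 2 :=
    (mul_le_mul_of_nonneg_right hsabs' (norm_nonneg A)).trans ht₀A
  set ε : ℝ := θ * s / 4 with hε
  have hεpos : 0 < ε := by positivity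
  obtain ⟨L₁, hL₁⟩ := HullBulkOptimal.sum_site_le_of_matched x hx hlim hεpos
  refine ⟨max L₁ 1 + 2 * C₁ / (3 * s * θ) + 4 * a * C₁ / θ, fun L hL c => ?_⟩
  have hq1 : 0 ≤ 2 * C₁ / (3 * s * θ) := by positivity
  have hq2 : 0 ≤ 4 * a * C₁ / θ := by positivity
  have hmax1 := le_max_right L₁ 1
  have hmax2 := le_max_left L₁ 1
  have hL1 : 1 ≤ L := by linarith
  have hL0 : 0 < L := by linarith
  have hLL₁ : L₁ ≤ L := by linarith
  have hLq1 : 2 * C₁ / (3 * s * θ) ≤ L := by linarith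
  have hLq2 : 4 * a * C₁ / θ ≤ L := by linarith
  /- (1) the finite set of points of the ball and the exterior -/
  set Yset : Set E3 := {y : E3 | y ∈ S ∧ dist y c ≤ L} with hYset
  have hYfin : Yset.Finite :=
    finite_of_forall_le_dist_of_subset_closedBall hδ
      (fun p hp q hq hpq => hsep p hp.1 q hq.1 hpq) (c := c) (R := L)
      (fun p hp => mem_closedBall.2 hp.2)
  set Yf : Finset E3 := hYfin.toFinset with hYf
  have hmemY : ∀ y : E3, y ∈ Yf ↔ y ∈ S ∧ dist y c ≤ L := fun y => by
    rw [hYf, Set.Finite.mem_toFinset]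
    rfl
  have hYS : ∀ y ∈ Yf, y ∈ S := fun y hy => ((hmemY y).1 hy).1
  have hsepY : ∀ p ∈ Yf, ∀ q ∈ Yf, p ≠ q → δ ≤ dist p q := fun p hp q hq hpq =>
    hsep p (hYS p hp) q (hYS q hq) hpq
  have hncard : Yset.ncard = Yf.card := Set.ncard_eq_toFinset_card Yset hYfin
  have hnK : (Yf.card : ℝ) ≤ K₀ * L ^ 3 := by
    have h := ncard_ball_le hδ hsep c hL0.le
    rw [hncard] at h
    have h2 : 2 * L / δ + 1 ≤ (2 / δ + 1) * L := by
      rw [add_mul, div_mul_eq_mul_div, mul_comm 2 L]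
      linarith
    calc (Yf.card : ℝ) ≤ (2 * L / δ + 1) ^ 3 := h
      _ ≤ ((2 / δ + 1) * L) ^ 3 := pow_le_pow_left₀ (by positivity) h2 3
      _ = K₀ * L ^ 3 := by rw [hK₀]; ring
  set O : Set E3 := {z : E3 | z ∈ S ∧ ¬ dist z c ≤ L} with hO
  have hsepO : ∀ p ∈ O, ∀ q ∈ O, p ≠ q → δ ≤ dist p q := fun p hp q hq hpq =>
    hsep p hp.1 q hq.1 hpq
  have hfarO : ∀ y ∈ Yf, ∀ z ∈ O, δ ≤ dist y z := fun y hy z hz =>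
    hsep y (hYS y hy) z hz.1 fun h => hz.2 (h ▸ ((hmemY y).1 hy).2)
  /- (2) summability over the exterior -/
  have hsum6 : ∀ y ∈ Yf, Summable fun z : O => (dist y (z : E3))⁻¹ ^ 6 := fun y hy =>
    (hzms_summable_inv_pow_six hδ y hsepO (hfarO y hy)).1
  have hsumV : ∀ y ∈ Yf, Summable fun z : O => lennardJones (dist y (z : E3)) := fun y hy => by
    refine Summable.of_norm_bounded ((hsum6 y hy).mul_left (δ⁻¹ ^ 6 / 12 + 1 / 6)) fun z => ?_
    rw [Real.norm_eq_abs]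
    exact abs_lennardJones_le hδ (hfarO y hy z z.2)
  have hψ : ∀ y ∈ Yf, ∀ z : O, |deriv lennardJones (dist y (z : E3)) / dist y (z : E3) *
      ⟪y - (z : E3), A (y - (z : E3))⟫| ≤ a * (dist y (z : E3))⁻¹ ^ 6 := fun y hy z => by
    rw [dist_eq_norm]
    have hu : δ ≤ ‖y - (z : E3)‖ := by
      rw [← dist_eq_norm]
      exact hfarO y hy z z.2
    exact hzms_abs_stress_le A hδ hu
  have hsumψ : ∀ y ∈ Yf, Summable fun z : O => deriv lennardJones (dist y (z : E3)) /
      dist y (z : E3) * ⟪y - (z : E3), A (y - (z : E3))⟫ := fun y hy => by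
    refine Summable.of_norm_bounded ((hsum6 y hy).mul_left a) fun z => ?_
    rw [Real.norm_eq_abs]
    exact hψ y hy z
  /- (3) the target and the bulk sum as finite sums of split site sums -/
  have hLHST : (∑' y : ↥Yset, ∑' z : ↥({z : E3 | z ∈ S ∧ z ≠ (y : E3)} : Set E3),
      deriv lennardJones (dist (y : E3) (z : E3)) / dist (y : E3) (z : E3) *
        ⟪(y : E3) - (z : E3), A ((y : E3) - (z : E3))⟫) =
      ∑ y ∈ Yf, ∑' z : ↥({z : E3 | z ∈ S ∧ z ≠ y} : Set E3),
        deriv lennardJones (dist y (z : E3)) / dist y (z : E3) * ⟪y - (z : E3), A (y - (z : E3))⟫ :=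
    tsum_finite_eq_sum hYfin fun y => ∑' z : ↥({z : E3 | z ∈ S ∧ z ≠ y} : Set E3),
      deriv lennardJones (dist y (z : E3)) / dist y (z : E3) * ⟪y - (z : E3), A (y - (z : E3))⟫
  rw [hLHST]
  have hsplitT : ∀ y ∈ Yf, ∑' z : ↥({z : E3 | z ∈ S ∧ z ≠ y} : Set E3),
      deriv lennardJones (dist y (z : E3)) / dist y (z : E3) * ⟪y - (z : E3), A (y - (z : E3))⟫ =
      ∑ z ∈ Yf.erase y, deriv lennardJones (dist y z) / dist y z * ⟪y - z, A (y - z)⟫ +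
        ∑' z : O, deriv lennardJones (dist y (z : E3)) / dist y (z : E3) *
          ⟪y - (z : E3), A (y - (z : E3))⟫ := fun y hy =>
    hzms_tsum_split hmemY hy
      (fun z => deriv lennardJones (dist y z) / dist y z * ⟪y - z, A (y - z)⟫) (hsumψ y hy)
  have hTeq : ∑ y ∈ Yf, ∑' z : ↥({z : E3 | z ∈ S ∧ z ≠ y} : Set E3),
      deriv lennardJones (dist y (z : E3)) / dist y (z : E3) * ⟪y - (z : E3), A (y - (z : E3))⟫ =
      ∑ y ∈ Yf, ∑ z ∈ Yf.erase y,
          (deriv lennardJones ‖y - z‖ / ‖y - z‖ * ⟪y - z, A (y - z)⟫) +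
        ∑ y ∈ Yf, ∑' z : O, deriv lennardJones (dist y (z : E3)) / dist y (z : E3) *
          ⟪y - (z : E3), A (y - (z : E3))⟫ := by
    rw [Finset.sum_congr rfl hsplitT, Finset.sum_add_distrib]
    simp only [dist_eq_norm]
  rw [hTeq]
  -- the empty ball
  rcases Yf.eq_empty_or_nonempty with hY0 | hYne
  · rw [hY0]
    simp only [Finset.sum_empty, add_zero, abs_zero]
    positivity
  have hnpos : 0 < Yf.card := Finset.card_pos.2 hYne
  /- (4) the bulk bound -/
  have hU := hL₁ L hLL₁ c
  rw [he_tend.liminf_eq, hncard] at hU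
  have hLHSU : (∑' y : ↥Yset, ∑' z : ↥({z : E3 | z ∈ S ∧ z ≠ (y : E3)} : Set E3),
      lennardJones (dist (y : E3) (z : E3))) =
      ∑ y ∈ Yf, ∑' z : ↥({z : E3 | z ∈ S ∧ z ≠ y} : Set E3), lennardJones (dist y (z : E3)) :=
    tsum_finite_eq_sum hYfin fun y =>
      ∑' z : ↥({z : E3 | z ∈ S ∧ z ≠ y} : Set E3), lennardJones (dist y (z : E3))
  rw [hLHSU] at hU
  have hsplitU : ∀ y ∈ Yf, ∑' z : ↥({z : E3 | z ∈ S ∧ z ≠ y} : Set E3),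
      lennardJones (dist y (z : E3)) =
      ∑ z ∈ Yf.erase y, lennardJones (dist y z) + ∑' z : O, lennardJones (dist y (z : E3)) :=
    fun y hy => hzms_tsum_split hmemY hy (fun z => lennardJones (dist y z)) (hsumV y hy)
  have hUeq : ∑ y ∈ Yf, ∑' z : ↥({z : E3 | z ∈ S ∧ z ≠ y} : Set E3),
      lennardJones (dist y (z : E3)) =
      ∑ y ∈ Yf, ∑ z ∈ Yf.erase y, lennardJones ‖y - z‖ +
        ∑ y ∈ Yf, ∑' z : O, lennardJones (dist y (z : E3)) := by
    rw [Finset.sum_congr rfl hsplitU, Finset.sum_add_distrib]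
    simp only [dist_eq_norm]
  rw [hUeq] at hU
  have hen : e * Yf.card ≤ groundStateEnergy lennardJones 3 Yf.card := by
    have h := he_le Yf.card hnpos
    rwa [le_div_iff₀ (by exact_mod_cast hnpos)] at h
  have hU' : ∑ y ∈ Yf, ∑ z ∈ Yf.erase y, lennardJones ‖y - z‖ +
      ∑ y ∈ Yf, ∑' z : O, lennardJones (dist y (z : E3)) ≤
      2 * groundStateEnergy lennardJones 3 Yf.card + ε * L ^ 3 := by
    linarith [hU, hen]
  /- (5) the boundary bounds -/
  have hQ : ∑ y ∈ Yf, ∑' z : O, (dist y (z : E3))⁻¹ ^ 6 ≤ C₁ * L ^ 2 :=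
    hzms_cross_tsum_le hδ hsep hL1 hmemY hcross
  have hX : -(1 / 6 * (C₁ * L ^ 2)) ≤ ∑ y ∈ Yf, ∑' z : O, lennardJones (dist y (z : E3)) := by
    have h1 : ∀ y ∈ Yf, -(1 / 6) * ∑' z : O, (dist y (z : E3))⁻¹ ^ 6 ≤
        ∑' z : O, lennardJones (dist y (z : E3)) := fun y hy => by
      rw [← tsum_mul_left]
      exact Summable.tsum_le_tsum
        (fun z => by
          have h := ExcessDecayLiouvilleFineGrains.neg_inv_pow_six_le_lennardJones
            (dist y (z : E3))
          linarith)
        ((hsum6 y hy).mul_left _) (hsumV y hy)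
    calc -(1 / 6 * (C₁ * L ^ 2)) ≤ -(1 / 6) * ∑ y ∈ Yf, ∑' z : O, (dist y (z : E3))⁻¹ ^ 6 := by
          linarith
      _ = ∑ y ∈ Yf, -(1 / 6) * ∑' z : O, (dist y (z : E3))⁻¹ ^ 6 := by rw [Finset.mul_sum]
      _ ≤ _ := Finset.sum_le_sum h1
  have hX' : |∑ y ∈ Yf, ∑' z : O, deriv lennardJones (dist y (z : E3)) / dist y (z : E3) *
      ⟪y - (z : E3), A (y - (z : E3))⟫| ≤ a * (C₁ * L ^ 2) := by
    calc |∑ y ∈ Yf, ∑' z : O, deriv lennardJones (dist y (z : E3)) / dist y (z : E3) *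
          ⟪y - (z : E3), A (y - (z : E3))⟫|
        ≤ ∑ y ∈ Yf, |∑' z : O, deriv lennardJones (dist y (z : E3)) / dist y (z : E3) *
          ⟪y - (z : E3), A (y - (z : E3))⟫| := Finset.abs_sum_le_sum_abs _ _
      _ ≤ ∑ y ∈ Yf, a * ∑' z : O, (dist y (z : E3))⁻¹ ^ 6 := Finset.sum_le_sum fun y hy => by
          rw [← tsum_mul_left]
          exact hzms_abs_tsum_le ((hsum6 y hy).mul_left a) (hψ y hy)
      _ = a * ∑ y ∈ Yf, ∑' z : O, (dist y (z : E3))⁻¹ ^ 6 := by rw [Finset.mul_sum]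
      _ ≤ a * (C₁ * L ^ 2) := mul_le_mul_of_nonneg_left hQ ha0
  /- (6) competitor and Taylor -/
  have hGp := hzms_competitor A hsA Yf
  have hGm := hzms_competitor A hsA' Yf
  have hTp := hzms_taylor_sum A hδ ht₀A Yf hsepY hsabs
  have hTm := hzms_taylor_sum A hδ ht₀A Yf hsepY hsabs'
  have hRp : 2 ^ 8 * (14 * (δ / 2)⁻¹ ^ 6 + 8) * ‖A‖ ^ 2 * (1024 / (δ ^ 3 * δ ^ 3)) * Yf.card * s ^ 2 ≤
      K * L ^ 3 * s ^ 2 := by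
    have h1 : K₄ * Yf.card ≤ K₄ * (K₀ * L ^ 3) := mul_le_mul_of_nonneg_left hnK hK₄0
    have h2 : K₄ * (K₀ * L ^ 3) = K * L ^ 3 := by rw [hK]; ring
    have h3 := mul_le_mul_of_nonneg_right h1 (sq_nonneg s)
    rw [h2] at h3
    simpa only [hK₄] using h3
  have hRm : 2 ^ 8 * (14 * (δ / 2)⁻¹ ^ 6 + 8) * ‖A‖ ^ 2 * (1024 / (δ ^ 3 * δ ^ 3)) * Yf.card *
      (-s) ^ 2 ≤ K * L ^ 3 * s ^ 2 := by
    rw [neg_sq]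
    exact hRp
  /- (7) endgame -/
  exact hzms_endgame hθ hs0 hL1 hε hsK hLq1 hLq2 hU' hX hGp hGm hTp hTm hRp hRm hX'

end Summit.AtomisticToContinuum.Crystallization.Theorems.AlphabetGoodHullElementCensusLiouville

end
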